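import Summits.Parity.GeneralizedHardyLittlewood.Theorems.BeyondDiagonalBeatsQuarter.OffDiagPoissonApplied
import HarnessLib

/-!
# Route `PrimeLevelFamEdge`, crux K_B (stmt-Parity-20343), line `diagonal_kernel_split` rev 4, plan Ω,
# worker key L3 (part 2) `OffDiagDualHyperbolaCount`: the number of dual frequencies in a box —
# `#{(h₁,h₂) : |h_j| ≤ A_j, h₁ a unit mod c, h₁h₂ ≡ γ (mod c)} ≤ (2A₁+1)·(2A₂/c + 1)`

After Ω-d5 / W-a the dual side of a Kloosterman layer (modulus `c = qr`) is a sum over `(h₁,h₂) ∈ ℤ²` weighted by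
`Φ̂_i(h/c)·N_c(α,β;h)`, and on the coprime stratum `N_c = 𝟙[h₁ ∈ (ℤ/c)ˣ ∧ h₁h₂ = αβ]` (`OffDiag.dualCount_le_one`,
`dualCount_eq_zero_of_ne`). L2 (`OffDiagDualTruncation*`, prover-2) truncates to `|h_j| ≤ A_j`; L3 part 1
(`OffDiagDualBoxSize`) bounds `|Φ̂_i|` uniformly. The remaining factor of the TRIVIAL ledger (BLUEPRINT §2: «hyperbola
density `≈ H₁H₂/(qr)`») is the COUNT proved here:
* `card_Icc_filter_intCast_eq_le` — a residue class mod `c` meets `[-A, A]` in `≤ 2A/c + 1` integers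
  (an arithmetic progression of step `c` in an interval of length `2A`);
* **`card_hyperbolaBox_le`** — `#{(h₁,h₂) ∈ [-A₁,A₁]×[-A₂,A₂] : IsUnit h₁ (mod c), h₁h₂ = γ (mod c)} ≤ (2A₁+1)(2A₂/c+1)`
  (for each unit `h₁` the class of `h₂` is `h₁⁻¹γ`).
Elementary counting; nothing about the heart. Helper (`--supports stmt-Parity-20343`); standard axioms.
«The programme SEARCHES and TYPES; no claim about Landau–Siegel zeros, Theorems 1–2 of arXiv:2211.02515 or
a repaired Margin232 until a kernel theorem says so.»
-/

noncomputable section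

open Finset

namespace Summit.Parity.GeneralizedHardyLittlewood.Theorems.BeyondDiagonalBeatsQuarter.OffDiag

/-! ### §1. A residue class in an interval -/

/-- **A residue class mod `c ≥ 1` meets `[-A, A]` in at most `2A/c + 1` integers.** [folklore] -/
theorem card_Icc_filter_intCast_eq_le (c : ℕ) [NeZero c] (A : ℕ) (w : ZMod c) :
    (((Finset.Icc (-(A : ℤ)) A).filter (fun h : ℤ ↦ (h : ZMod c) = w)).card : ℝ) ≤ 2 * A / c + 1 := by
  classical
  have hc0 : 0 < c := Nat.pos_of_ne_zero (NeZero.ne c)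
  have hcz : (0 : ℤ) < c := by exact_mod_cast hc0
  set S := (Finset.Icc (-(A : ℤ)) A).filter (fun h : ℤ ↦ (h : ZMod c) = w) with hS
  rcases S.eq_empty_or_nonempty with hempty | hne
  · rw [hempty, Finset.card_empty]; push_cast; positivity
  set m : ℤ := S.min' hne with hm
  have hmS : m ∈ S := Finset.min'_mem S hne
  have hmem : ∀ h ∈ S, -(A : ℤ) ≤ h ∧ h ≤ A ∧ (h : ZMod c) = w := fun h hh ↦ by
    have := Finset.mem_filter.1 hh
    exact ⟨(Finset.mem_Icc.1 this.1).1, (Finset.mem_Icc.1 this.1).2, this.2⟩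
  -- every element is `m + c·t` with `0 ≤ t ≤ 2A/c`
  have hdvd : ∀ h ∈ S, (c : ℤ) ∣ h - m := fun h hh ↦ by
    have h1 := (hmem h hh).2.2
    have h2 := (hmem m hmS).2.2
    exact (ZMod.intCast_eq_intCast_iff_dvd_sub m h c).1 (by rw [h1, h2])
  have hrange : ∀ h ∈ S, 0 ≤ (h - m) / c ∧ (h - m) / c ≤ 2 * A / c := by
    intro h hh
    have hmin : m ≤ h := Finset.min'_le S h hh
    have hA := (hmem h hh).2.1
    have hmA := (hmem m hmS).1
    refine ⟨Int.ediv_nonneg (by linarith) hcz.le, Int.ediv_le_ediv hcz (by linarith)⟩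
  -- the injection `h ↦ ((h - m)/c).toNat` into `range (2A/c + 1)`
  set f : ℤ → ℕ := fun h ↦ ((h - m) / c).toNat with hf
  have hmaps : ∀ h ∈ S, f h ∈ Finset.range ((2 * A) / c + 1) := by
    intro h hh
    obtain ⟨h0, h1⟩ := hrange h hh
    rw [Finset.mem_range, Nat.lt_add_one_iff, hf]
    have : (((h - m) / c).toNat : ℤ) ≤ ((2 * A / c : ℕ) : ℤ) := by
      rw [Int.toNat_of_nonneg h0]; push_cast; exact h1
    exact_mod_cast this
  have hinj : Set.InjOn f S := by
    intro h hh h' hh' hfe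
    obtain ⟨h0, -⟩ := hrange h hh
    obtain ⟨h0', -⟩ := hrange h' hh'
    simp only [hf] at hfe
    have he : (h - m) / c = (h' - m) / c := by
      have := congrArg (fun n : ℕ ↦ (n : ℤ)) hfe
      simpa [Int.toNat_of_nonneg h0, Int.toNat_of_nonneg h0'] using this
    have h1 := Int.ediv_mul_cancel (hdvd h hh)
    have h2 := Int.ediv_mul_cancel (hdvd h' hh')
    have : h - m = h' - m := by rw [← h1, ← h2, he]
    linarith
  have hcard := Finset.card_le_card_of_injOn f hmaps hinj
  rw [Finset.card_range] at hcard
  calc (S.card : ℝ) ≤ ((2 * A / c + 1 : ℕ) : ℝ) := by exact_mod_cast hcard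
    _ = ((2 * A / c : ℕ) : ℝ) + 1 := by push_cast; ring
    _ ≤ 2 * A / c + 1 := by
        have : ((2 * A / c : ℕ) : ℝ) ≤ 2 * A / c := by
          rw [le_div_iff₀ (by exact_mod_cast hc0)]
          exact_mod_cast Nat.div_mul_le_self (2 * A) c
        linarith

/-! ### §2. The hyperbola in a dual box -/

/-- **The number of dual frequencies in a box.** For `c ≥ 1`, `A₁, A₂ ∈ ℕ` and `γ ∈ ℤ/c`:
`#{(h₁,h₂) ∈ [-A₁,A₁]×[-A₂,A₂] : h₁ a unit mod c, h₁·h₂ = γ in ℤ/c} ≤ (2A₁+1)·(2A₂/c + 1)`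
(the class of `h₂` is determined by the unit `h₁`). [cite: KowalskiMichelVanderKam2000, Lemma 3.3 p. 9 — derivation] -/
theorem card_hyperbolaBox_le (c : ℕ) [NeZero c] (A₁ A₂ : ℕ) (γ : ZMod c) :
    ((((Finset.Icc (-(A₁ : ℤ)) A₁) ×ˢ (Finset.Icc (-(A₂ : ℤ)) A₂)).filter
        (fun h : ℤ × ℤ ↦ IsUnit ((h.1 : ℤ) : ZMod c) ∧ ((h.1 : ℤ) : ZMod c) * ((h.2 : ℤ) : ZMod c) = γ)).card : ℝ) ≤
      (2 * A₁ + 1) * (2 * A₂ / c + 1) := by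
  classical
  set S := ((Finset.Icc (-(A₁ : ℤ)) A₁) ×ˢ (Finset.Icc (-(A₂ : ℤ)) A₂)).filter
    (fun h : ℤ × ℤ ↦ IsUnit ((h.1 : ℤ) : ZMod c) ∧ ((h.1 : ℤ) : ZMod c) * ((h.2 : ℤ) : ZMod c) = γ) with hS
  -- fibre over `h₁`
  have hfst : ∀ h ∈ S, h.1 ∈ Finset.Icc (-(A₁ : ℤ)) A₁ := fun h hh ↦
    (Finset.mem_product.1 (Finset.mem_filter.1 hh).1).1
  have hfib : ∀ h₁ ∈ Finset.Icc (-(A₁ : ℤ)) A₁,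
      ((S.filter (fun h : ℤ × ℤ ↦ h.1 = h₁)).card : ℝ) ≤ 2 * A₂ / c + 1 := by
    intro h₁ _
    set T := (Finset.Icc (-(A₂ : ℤ)) A₂).filter
      (fun h₂ : ℤ ↦ (h₂ : ZMod c) = ((h₁ : ℤ) : ZMod c)⁻¹ * γ) with hT
    have hmaps : ∀ h ∈ S.filter (fun h : ℤ × ℤ ↦ h.1 = h₁), h.2 ∈ T := by
      intro h hh
      obtain ⟨hS', h1⟩ := Finset.mem_filter.1 hh
      obtain ⟨hbox, hunit, hprod⟩ := Finset.mem_filter.1 hS'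
      rw [hT, Finset.mem_filter]
      refine ⟨(Finset.mem_product.1 hbox).2, ?_⟩
      subst h1
      calc ((h.2 : ℤ) : ZMod c) = ((h.1 : ℤ) : ZMod c)⁻¹ * (((h.1 : ℤ) : ZMod c) * ((h.2 : ℤ) : ZMod c)) := by
            rw [← mul_assoc, ZMod.inv_mul_of_unit _ hunit, one_mul]
        _ = ((h.1 : ℤ) : ZMod c)⁻¹ * γ := by rw [hprod]
    have hinj : Set.InjOn (fun h : ℤ × ℤ ↦ h.2) (S.filter (fun h : ℤ × ℤ ↦ h.1 = h₁) : Set (ℤ × ℤ)) := by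
      intro h hh h' hh' he
      have e1 : h.1 = h₁ := (Finset.mem_filter.1 (Finset.mem_coe.1 hh)).2
      have e2 : h'.1 = h₁ := (Finset.mem_filter.1 (Finset.mem_coe.1 hh')).2
      exact Prod.ext (e1.trans e2.symm) he
    have hle := Finset.card_le_card_of_injOn (fun h : ℤ × ℤ ↦ h.2) hmaps hinj
    exact (Nat.cast_le.2 hle).trans (card_Icc_filter_intCast_eq_le c A₂ _)
  rw [Finset.card_eq_sum_card_fiberwise hfst]
  push_cast
  calc ∑ h₁ ∈ Finset.Icc (-(A₁ : ℤ)) A₁, ((S.filter (fun h : ℤ × ℤ ↦ h.1 = h₁)).card : ℝ)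
      ≤ ∑ h₁ ∈ Finset.Icc (-(A₁ : ℤ)) A₁, (2 * A₂ / c + 1 : ℝ) := Finset.sum_le_sum hfib
    _ = (2 * A₁ + 1) * (2 * A₂ / c + 1) := by
        rw [Finset.sum_const, nsmul_eq_mul, Int.card_Icc]
        congr 1
        rw [show (A₁ : ℤ) + 1 - -(A₁ : ℤ) = ((2 * A₁ + 1 : ℕ) : ℤ) by push_cast; ring, Int.toNat_natCast]
        push_cast
        ring

end Summit.Parity.GeneralizedHardyLittlewood.Theorems.BeyondDiagonalBeatsQuarter.OffDiag
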